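import Summits.QuantumFields.BalabanUV.T4Continuum.Support.NE3CovariantTentInterpolant
import Summits.QuantumFields.BalabanUV.T4Continuum.Support.NE3CovariantVertexDefect
import HarnessLib

/-!
# T⁴ programme, node NE3 — row E-MLw-(w4)-P-curved, route H♮, row K5c (file 2): THE COVARIANT DIRICHLET ENERGY OF THE
# COVARIANT TENT INTERPOLANT — the pointwise bound on every fine bond and the summed END in the S7 shape

NE3 (node U1b) formalisation swarm, leaf seat `b2b-balaban-t4-ne3-formalise-leaf-01` (gen 6); row **K5** of ruling ρ-g22-2
(`HOME/t4/b2b-balaban-t4-ne3-p1/g22/D-ne3p1-g22-1.md` §2 S7), sub-row **K5c** (FINDING F-ne3leaf01g6-1 ∕ INTENT, `HOME/CLAIMS.log`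
2026-08-20 ≈18:08Z ∕ ≈18:15Z).  Sequel of `NE3CovariantTentInterpolant` (file 1: the object `tinterpW`, its exact properties, the
covariant difference formula `gaugeDir_tinterpW_eq` and the two transport estimates `norm_sameVertex_le` ∕ `norm_coarseSlot_le`),
consumed BY NAME.

CONTENT ([folklore]; 0 sorry; 0 def), `[Nonempty n]`, `M ≥ 1`, `W`, `U` unitary, `SmallField W a`, `0 ≤ a`, `‖U − bseg M W‖ ≤ δ` bondwise:
§4 cell geometry (`|y − M•(blk M y + indic T)|_∞ ≤ M`, so every tree leg has `ℓ¹`-length `≤ d·M` and the two-leg loop `≤ 3dM`) and the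
   POINTWISE bound **`normSq_gaugeDir_tinterpW_le`** on EVERY fine bond `(y, α)`, `z = blk M y`:
   `‖gaugeDir W (tinterpW M W m) y α‖² ≤ (4∕M²)·Σ_{T ⊆ univ∖α} ‖gaugeDir U m (z + indic T) α‖² + (8(dMa)² + (16∕M²)(δ + 9d²M²a)²)·Σ_{T ⊆ univ} ‖m (z + indic T)‖²`;
§5 THE END **`sum_normSq_gaugeDir_tinterpW_le`** (`N ≥ 1`, `m` and `U` `N`-periodic; blocks by `sum_periodBox_blocks`, vertex shifts by
   `sum_periodBox_shift` — the H3∕K5a pattern):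
   `Σ_{y∈periodBox(M·N)} Σ_α ‖gaugeDir W (tinterpW M W m) y α‖² ≤ 2^{d+1}·(M^d∕M²)·Σ_{z∈periodBox N} Σ_α ‖gaugeDir U m z α‖²
      + d·2^d·M^d·(8(dMa)² + (16∕M²)(δ + 9d²M²a)²)·Σ_{z∈periodBox N} ‖m z‖²`
   — the S7 shape `C_I M^{d−2}[Σ‖D_U m‖² + C(d)((M²a)² + δ²)Σ‖m‖²]` (`M²a ≤ b∕L²`), `k`-free, `N`-free, for ANY unitary coarse `U`.

HONEST FRAMING.  Kinematics of OUR competitor at one background in the small-field class; nothing about Bałaban's minimisers;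
(P♮)_W ∕ (ML_w) at W ≠ 1, T-E_w and **NE3 are NOT proved**; spine PROVED 0∕9; finite T⁴ rung (B)+1 — NOT infinite volume, NOT
mass gap, NOT `BetaPertH`, NOT Clay.  PLACEMENT: `Summits/QuantumFields/BalabanUV/`.  HONEST DEPENDENCY (cell page 1): continuum YM
on T⁴ ⇐ BetaPertH ∧ nine spine estimates (0/9 proved); BetaPertH ⇐ (D1) ∧ (D4) ∧ CAP+tail; G-an2-4 gates asym, D1 and NE2/3/4.
-/

set_option autoImplicit false

open scoped BigOperators Matrix.Norms.L2Operator
open Finset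

namespace Summit.QuantumFields.BalabanUV.T4Continuum.NE3CovariantTentInterpolantEnergy

open Literature.MathematicalPhysics.QuantumFieldTheory.Balaban1983to89
open B7Prop1Explicit B7Prop2Explicit
open T4AveragingDeficitWall (IsUnitaryCfg SmallField Ad)
open T4AveragingDeficitWallBoundary (periodBox mem_periodBox card_periodBox IsPeriodicCfg sum_periodBox_shift)
open AveragingDeficitTransport (norm_Ad_of_unitary)
open AveragingDeficitBlockDensity (btree bseg btree_mem)
open BlockAveragePushDirGauge (gaugeDir)
open SmoothRefineBlocks (blk res blk_add_res res_nonneg res_lt)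
open SmoothRefineInterp (indic indic_apply indic_insert cfd interp)
open NE3CoarseInterpolant (normSq_interp_le blk_block)
open NE3BlockLineAverage (sum_periodBox_blocks)
open NE3CovariantTentInterpolant (vtxW tinterpW gaugeDir_tinterpW_eq norm_sameVertex_le norm_coarseSlot_le)
open NE3CovariantVertexDefect (l1_le_of_abs_le')

noncomputable section

variable {d : ℕ} {n : Type*} [Fintype n] [DecidableEq n]

/-! ## §4 The pointwise bound on every fine bond -/

/-- Coordinates of a fine site relative to the corners of its cell: `|(y − M•(blk M y + indic T))_j| ≤ M`. [folklore] -/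
theorem abs_sub_vertex_le {M : ℕ} (hM : 1 ≤ M) (y : Site d) (T : Finset (Fin d)) (j : Fin d) :
    -(M : ℤ) ≤ (y - (M : ℤ) • (blk M y + indic T)) j ∧ (y - (M : ℤ) • (blk M y + indic T)) j ≤ M := by
  have h := congr_fun (blk_add_res M y) j
  have h0 := res_nonneg hM y j
  have h1 := res_lt hM y j
  simp only [Pi.add_apply, Pi.smul_apply, smul_eq_mul, Pi.sub_apply, indic_apply] at h ⊢
  split_ifs <;> constructor <;> nlinarith

/-- … and for the shifted site `y + e_α`: `|(y + e_α − M•(blk M y + indic T))_j| ≤ M` (`M ≥ 1`). [folklore] -/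
theorem abs_add_e_sub_vertex_le {M : ℕ} (hM : 1 ≤ M) (y : Site d) (α : Fin d) (T : Finset (Fin d)) (j : Fin d) :
    -(M : ℤ) ≤ (y + e α - (M : ℤ) • (blk M y + indic T)) j ∧ (y + e α - (M : ℤ) • (blk M y + indic T)) j ≤ M := by
  have h := congr_fun (blk_add_res M y) j
  have h0 := res_nonneg hM y j
  have h1 := res_lt hM y j
  have hM1 : (1 : ℤ) ≤ M := by exact_mod_cast hM
  simp only [Pi.add_apply, Pi.smul_apply, smul_eq_mul, Pi.sub_apply, indic_apply, e_apply] at h ⊢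
  split_ifs <;> constructor <;> nlinarith

section Pointwise

variable [Nonempty n]

/-- **THE COVARIANT GRADIENT OF THE TENT INTERPOLANT, POINTWISE** (`M ≥ 1`; `W`, `U` unitary; `SmallField W a`, `0 ≤ a`;
`‖U − bseg M W‖ ≤ δ` bondwise): on EVERY fine bond `(y, α)`, with `z = blk M y`,
`‖gaugeDir W (tinterpW M W m) y α‖² ≤ (4∕M²)·Σ_{T ⊆ univ∖α} ‖gaugeDir U m (z + indic T) α‖²
  + (8·(d·M·a)² + (16∕M²)·(δ + 9d²M²a)²)·Σ_{T ⊆ univ} ‖m (z + indic T)‖²`. [folklore] -/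
theorem normSq_gaugeDir_tinterpW_le {M : ℕ} (hM : 1 ≤ M) {W U : Site d → Fin d → (Matrix n n ℂ)ˣ} (hW : IsUnitaryCfg W)
    (hU : IsUnitaryCfg U) {a δ : ℝ} (ha : 0 ≤ a) (hWa : SmallField W a)
    (hδ : ∀ (w : Site d) (α : Fin d), ‖((U w α : (Matrix n n ℂ)ˣ) : Matrix n n ℂ) - bseg M W w α‖ ≤ δ)
    (m : Site d → Matrix n n ℂ) (y : Site d) (α : Fin d) :
    ‖gaugeDir W (tinterpW M W m) y α‖ ^ 2
      ≤ (4 / (M : ℝ) ^ 2) * ∑ T ∈ (Finset.univ.erase α).powerset, ‖gaugeDir U m (blk M y + indic T) α‖ ^ 2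
        + (8 * ((d : ℝ) * M * a) ^ 2 + (16 / (M : ℝ) ^ 2) * (δ + 9 * (d : ℝ) ^ 2 * (M : ℝ) ^ 2 * a) ^ 2)
          * ∑ T ∈ (Finset.univ : Finset (Fin d)).powerset, ‖m (blk M y + indic T)‖ ^ 2 := by
  have hM0 : (0 : ℝ) < M := by exact_mod_cast (by omega : 0 < M)
  have hd1 : (1 : ℝ) ≤ d := by exact_mod_cast Fin.pos α
  have hδ0 : 0 ≤ δ := (norm_nonneg _).trans (hδ 0 α)
  set z : Site d := blk M y with hz
  set Afun : Site d → Matrix n n ℂ :=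
    fun w => Ad (btree M W w (y + e α))⁻¹ (Ad (gaugeAct (btree M W w) W y α)⁻¹ (m w) - m w) with hAfun
  set G : Site d → Matrix n n ℂ := vtxW M W m (y + e α) with hG
  set Sm : ℝ := ∑ T ∈ (Finset.univ : Finset (Fin d)).powerset, ‖m (z + indic T)‖ ^ 2 with hSm
  set SD : ℝ := ∑ T ∈ (Finset.univ.erase α).powerset, ‖gaugeDir U m (z + indic T) α‖ ^ 2 with hSD
  have hSm0 : 0 ≤ Sm := Finset.sum_nonneg fun _ _ => sq_nonneg _
  have hSD0 : 0 ≤ SD := Finset.sum_nonneg fun _ _ => sq_nonneg _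
  -- Term A: the same-vertex defects, by local convexity
  have hA : ‖interp M Finset.univ Afun y‖ ^ 2 ≤ (2 * ((d : ℝ) * M * a)) ^ 2 * Sm := by
    refine (normSq_interp_le hM _ Afun y).trans ?_
    rw [hSm, Finset.mul_sum]
    refine Finset.sum_le_sum fun T _ => ?_
    have h1 := norm_sameVertex_le (M := M) hW ha hWa (m (z + indic T)) y (z + indic T) α
    have hl1 : (l1 (y - (M : ℤ) • (z + indic T)) : ℝ) ≤ (d : ℝ) * M := by
      exact_mod_cast l1_le_of_abs_le' (fun j => abs_sub_vertex_le hM y T j)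
    have h2 : ‖Afun (z + indic T)‖ ≤ 2 * ((d : ℝ) * M * a) * ‖m (z + indic T)‖ := by
      refine h1.trans ?_
      have : (l1 (y - (M : ℤ) • (z + indic T)) : ℝ) * a ≤ (d : ℝ) * M * a := mul_le_mul_of_nonneg_right hl1 ha
      gcongr
    calc ‖Afun (z + indic T)‖ ^ 2 ≤ (2 * ((d : ℝ) * M * a) * ‖m (z + indic T)‖) ^ 2 :=
          pow_le_pow_left₀ (norm_nonneg _) h2 2
      _ = (2 * ((d : ℝ) * M * a)) ^ 2 * ‖m (z + indic T)‖ ^ 2 := by ring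
  -- Term B: the coarse-difference slot, vertex by vertex
  have hBpt : ∀ T ∈ (Finset.univ.erase α).powerset,
      ‖cfd α G (z + indic T)‖ ^ 2
        ≤ 2 * ‖gaugeDir U m (z + indic T) α‖ ^ 2
          + 8 * (δ + 9 * (d : ℝ) ^ 2 * (M : ℝ) ^ 2 * a) ^ 2 * ‖m (z + indic T)‖ ^ 2 := by
    intro T hT
    have hαT : α ∉ T := by
      intro h
      have := Finset.mem_powerset.1 hT h
      simp at this
    set w : Site d := z + indic T with hw
    have h2 := norm_coarseSlot_le (M := M) hW hU ha hWa hδ m (y + e α) w α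
    -- the loop length is at most `3dM`
    have hla : l1 (y + e α - (M : ℤ) • w) ≤ d * M := l1_le_of_abs_le' (fun j => abs_add_e_sub_vertex_le hM y α T j)
    have hlb : l1 (y + e α - (M : ℤ) • (w + e α)) ≤ d * M := by
      have hw' : w + e α = z + indic (insert α T) := by rw [indic_insert hαT, hw]; abel
      rw [hw']
      exact l1_le_of_abs_le' (fun j => abs_add_e_sub_vertex_le hM y α (insert α T) j)
    have hℓ : (((l1 (y + e α - (M : ℤ) • w) + l1 (y + e α - (M : ℤ) • (w + e α)) + M : ℕ) : ℝ)) ≤ 3 * (d : ℝ) * M := by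
      have h3 : l1 (y + e α - (M : ℤ) • w) + l1 (y + e α - (M : ℤ) • (w + e α)) + M ≤ d * M + d * M + M := by omega
      have h4 : ((d * M + d * M + M : ℕ) : ℝ) ≤ 3 * (d : ℝ) * M := by
        push_cast
        have hM1 : (0 : ℝ) ≤ M := hM0.le
        nlinarith
      exact le_trans (by exact_mod_cast h3) h4
    have hℓsq : (((l1 (y + e α - (M : ℤ) • w) + l1 (y + e α - (M : ℤ) • (w + e α)) + M : ℕ) : ℝ)) ^ 2 * a + δ
        ≤ 9 * (d : ℝ) ^ 2 * (M : ℝ) ^ 2 * a + δ := by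
      have := pow_le_pow_left₀ (by positivity) hℓ 2
      nlinarith
    have hslot : ‖cfd α G w + Ad (btree M W (w + e α) (y + e α))⁻¹ (gaugeDir U m w α)‖
        ≤ 2 * (9 * (d : ℝ) ^ 2 * (M : ℝ) ^ 2 * a + δ) * ‖m w‖ :=
      h2.trans (by gcongr)
    have htri : ‖cfd α G w‖ ≤ ‖gaugeDir U m w α‖ + 2 * (9 * (d : ℝ) ^ 2 * (M : ℝ) ^ 2 * a + δ) * ‖m w‖ := by
      have hD : ‖Ad (btree M W (w + e α) (y + e α))⁻¹ (gaugeDir U m w α)‖ = ‖gaugeDir U m w α‖ :=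
        norm_Ad_of_unitary ((unitaryUnits _).inv_mem (btree_mem hW M _ _)) _
      calc ‖cfd α G w‖ = ‖(cfd α G w + Ad (btree M W (w + e α) (y + e α))⁻¹ (gaugeDir U m w α))
              - Ad (btree M W (w + e α) (y + e α))⁻¹ (gaugeDir U m w α)‖ := by rw [add_sub_cancel_right]
        _ ≤ ‖cfd α G w + Ad (btree M W (w + e α) (y + e α))⁻¹ (gaugeDir U m w α)‖
              + ‖Ad (btree M W (w + e α) (y + e α))⁻¹ (gaugeDir U m w α)‖ := norm_sub_le _ _
        _ ≤ 2 * (9 * (d : ℝ) ^ 2 * (M : ℝ) ^ 2 * a + δ) * ‖m w‖ + ‖gaugeDir U m w α‖ := add_le_add hslot hD.le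
        _ = _ := add_comm _ _
    have hK0 : 0 ≤ 2 * (9 * (d : ℝ) ^ 2 * (M : ℝ) ^ 2 * a + δ) * ‖m w‖ := by positivity
    calc ‖cfd α G w‖ ^ 2 ≤ (‖gaugeDir U m w α‖ + 2 * (9 * (d : ℝ) ^ 2 * (M : ℝ) ^ 2 * a + δ) * ‖m w‖) ^ 2 :=
          pow_le_pow_left₀ (norm_nonneg _) htri 2
      _ ≤ 2 * ‖gaugeDir U m w α‖ ^ 2 + 2 * (2 * (9 * (d : ℝ) ^ 2 * (M : ℝ) ^ 2 * a + δ) * ‖m w‖) ^ 2 := by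
          nlinarith [sq_nonneg (‖gaugeDir U m w α‖ - 2 * (9 * (d : ℝ) ^ 2 * (M : ℝ) ^ 2 * a + δ) * ‖m w‖)]
      _ = 2 * ‖gaugeDir U m w α‖ ^ 2 + 8 * (δ + 9 * (d : ℝ) ^ 2 * (M : ℝ) ^ 2 * a) ^ 2 * ‖m w‖ ^ 2 := by ring
  have hB : ‖interp M (Finset.univ.erase α) (cfd α G) y‖ ^ 2
      ≤ 2 * SD + 8 * (δ + 9 * (d : ℝ) ^ 2 * (M : ℝ) ^ 2 * a) ^ 2 * Sm := by
    refine (normSq_interp_le hM _ (cfd α G) y).trans ?_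
    calc ∑ T ∈ (Finset.univ.erase α).powerset, ‖cfd α G (z + indic T)‖ ^ 2
        ≤ ∑ T ∈ (Finset.univ.erase α).powerset, (2 * ‖gaugeDir U m (z + indic T) α‖ ^ 2
            + 8 * (δ + 9 * (d : ℝ) ^ 2 * (M : ℝ) ^ 2 * a) ^ 2 * ‖m (z + indic T)‖ ^ 2) := Finset.sum_le_sum hBpt
      _ = 2 * SD + 8 * (δ + 9 * (d : ℝ) ^ 2 * (M : ℝ) ^ 2 * a) ^ 2
            * ∑ T ∈ (Finset.univ.erase α).powerset, ‖m (z + indic T)‖ ^ 2 := by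
          rw [Finset.sum_add_distrib, ← Finset.mul_sum, ← Finset.mul_sum]
      _ ≤ 2 * SD + 8 * (δ + 9 * (d : ℝ) ^ 2 * (M : ℝ) ^ 2 * a) ^ 2 * Sm := by
          have hsub : ∑ T ∈ (Finset.univ.erase α).powerset, ‖m (z + indic T)‖ ^ 2 ≤ Sm :=
            Finset.sum_le_sum_of_subset_of_nonneg (Finset.powerset_mono.mpr (Finset.erase_subset α _))
              fun T _ _ => sq_nonneg _
          gcongr
  -- assembly
  rw [gaugeDir_tinterpW_eq hM W m y α]
  have hsplit : ‖interp M Finset.univ Afun y - (1 / (M : ℝ)) • interp M (Finset.univ.erase α) (cfd α G) y‖ ^ 2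
      ≤ 2 * ‖interp M Finset.univ Afun y‖ ^ 2 + 2 * ((1 / (M : ℝ)) ^ 2 * ‖interp M (Finset.univ.erase α) (cfd α G) y‖ ^ 2) := by
    have h := norm_sub_le (interp M Finset.univ Afun y) ((1 / (M : ℝ)) • interp M (Finset.univ.erase α) (cfd α G) y)
    rw [norm_smul, Real.norm_of_nonneg (by positivity)] at h
    calc _ ≤ (‖interp M Finset.univ Afun y‖ + 1 / (M : ℝ) * ‖interp M (Finset.univ.erase α) (cfd α G) y‖) ^ 2 :=
          pow_le_pow_left₀ (norm_nonneg _) h 2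
      _ ≤ _ := by
          rw [← mul_pow]
          nlinarith [sq_nonneg (‖interp M Finset.univ Afun y‖ - 1 / (M : ℝ) * ‖interp M (Finset.univ.erase α) (cfd α G) y‖)]
  have hM2 : (1 / (M : ℝ)) ^ 2 = 1 / (M : ℝ) ^ 2 := by rw [div_pow, one_pow]
  rw [hM2] at hsplit
  have hfinal : 2 * ‖interp M Finset.univ Afun y‖ ^ 2 + 2 * (1 / (M : ℝ) ^ 2 * ‖interp M (Finset.univ.erase α) (cfd α G) y‖ ^ 2)
      ≤ (4 / (M : ℝ) ^ 2) * SD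
        + (8 * ((d : ℝ) * M * a) ^ 2 + (16 / (M : ℝ) ^ 2) * (δ + 9 * (d : ℝ) ^ 2 * (M : ℝ) ^ 2 * a) ^ 2) * Sm := by
    have hM2pos : 0 < 1 / (M : ℝ) ^ 2 := by positivity
    have hB' := mul_le_mul_of_nonneg_left hB hM2pos.le
    calc 2 * ‖interp M Finset.univ Afun y‖ ^ 2 + 2 * (1 / (M : ℝ) ^ 2 * ‖interp M (Finset.univ.erase α) (cfd α G) y‖ ^ 2)
        ≤ 2 * ((2 * ((d : ℝ) * M * a)) ^ 2 * Sm)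
          + 2 * (1 / (M : ℝ) ^ 2 * (2 * SD + 8 * (δ + 9 * (d : ℝ) ^ 2 * (M : ℝ) ^ 2 * a) ^ 2 * Sm)) := by gcongr
      _ = (4 / (M : ℝ) ^ 2) * SD
          + (8 * ((d : ℝ) * M * a) ^ 2 + (16 / (M : ℝ) ^ 2) * (δ + 9 * (d : ℝ) ^ 2 * (M : ℝ) ^ 2 * a) ^ 2) * Sm := by ring
  exact hsplit.trans hfinal

end Pointwise

/-! ## §5 The summed END over one period -/

section End

variable [Nonempty n]

/-- **THE COVARIANT DIRICHLET ENERGY OF THE COVARIANT TENT INTERPOLANT — THE S7 SHAPE** (`M, N ≥ 1`; `W`, `U` unitary;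
`SmallField W a`, `0 ≤ a`; `‖U − bseg M W‖ ≤ δ` bondwise; `m` and `U` `N`-periodic):
`Σ_{y∈periodBox(M·N)} Σ_α ‖gaugeDir W (tinterpW M W m) y α‖² ≤ 2^{d+1}·(M^d∕M²)·Σ_{z∈periodBox N} Σ_α ‖gaugeDir U m z α‖²
  + d·2^d·M^d·(8(dMa)² + (16∕M²)(δ + 9d²M²a)²)·Σ_{z∈periodBox N} ‖m z‖²` — `C_I M^{d−2}[Σ‖D_U m‖² + C(d)((M²a)² + δ²)Σ‖m‖²]`,
`k`-free and `N`-free. [folklore] -/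
theorem sum_normSq_gaugeDir_tinterpW_le {M N : ℕ} (hM : 1 ≤ M) (hN : 1 ≤ N) {W U : Site d → Fin d → (Matrix n n ℂ)ˣ}
    (hW : IsUnitaryCfg W) (hU : IsUnitaryCfg U) {a δ : ℝ} (ha : 0 ≤ a) (hWa : SmallField W a)
    (hδ : ∀ (w : Site d) (α : Fin d), ‖((U w α : (Matrix n n ℂ)ˣ) : Matrix n n ℂ) - bseg M W w α‖ ≤ δ)
    (hUP : IsPeriodicCfg U (N : ℤ)) {m : Site d → Matrix n n ℂ} (hm : ∀ (z : Site d) (τ : Fin d), m (z + (N : ℤ) • e τ) = m z) :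
    ∑ y ∈ periodBox (d := d) (M * N), ∑ α : Fin d, ‖gaugeDir W (tinterpW M W m) y α‖ ^ 2
      ≤ (2 : ℝ) ^ (d + 1) * ((M : ℝ) ^ d / (M : ℝ) ^ 2)
          * ∑ z ∈ periodBox (d := d) N, ∑ α : Fin d, ‖gaugeDir U m z α‖ ^ 2
        + (d : ℝ) * (2 : ℝ) ^ d * (M : ℝ) ^ d
          * (8 * ((d : ℝ) * M * a) ^ 2 + (16 / (M : ℝ) ^ 2) * (δ + 9 * (d : ℝ) ^ 2 * (M : ℝ) ^ 2 * a) ^ 2)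
          * ∑ z ∈ periodBox (d := d) N, ‖m z‖ ^ 2 := by
  have hM0 : (0 : ℝ) < M := by exact_mod_cast (by omega : 0 < M)
  set K : ℝ := 8 * ((d : ℝ) * M * a) ^ 2 + (16 / (M : ℝ) ^ 2) * (δ + 9 * (d : ℝ) ^ 2 * (M : ℝ) ^ 2 * a) ^ 2 with hK
  set Dm : ℝ := ∑ z ∈ periodBox (d := d) N, ‖m z‖ ^ 2 with hDm
  -- the pointwise bound, written with `blk M y`
  have hpt : ∀ (y : Site d) (α : Fin d), ‖gaugeDir W (tinterpW M W m) y α‖ ^ 2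
      ≤ (4 / (M : ℝ) ^ 2) * ∑ T ∈ (Finset.univ.erase α).powerset, ‖gaugeDir U m (blk M y + indic T) α‖ ^ 2
        + K * ∑ T ∈ (Finset.univ : Finset (Fin d)).powerset, ‖m (blk M y + indic T)‖ ^ 2 :=
    fun y α => normSq_gaugeDir_tinterpW_le hM hW hU ha hWa hδ m y α
  -- block by block: the block of `M•z + v` is `z`
  have hblocks : ∑ y ∈ periodBox (d := d) (M * N), ∑ α : Fin d,
      ((4 / (M : ℝ) ^ 2) * ∑ T ∈ (Finset.univ.erase α).powerset, ‖gaugeDir U m (blk M y + indic T) α‖ ^ 2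
        + K * ∑ T ∈ (Finset.univ : Finset (Fin d)).powerset, ‖m (blk M y + indic T)‖ ^ 2)
      = (M : ℝ) ^ d * ∑ z ∈ periodBox (d := d) N, ∑ α : Fin d,
          ((4 / (M : ℝ) ^ 2) * ∑ T ∈ (Finset.univ.erase α).powerset, ‖gaugeDir U m (z + indic T) α‖ ^ 2
            + K * ∑ T ∈ (Finset.univ : Finset (Fin d)).powerset, ‖m (z + indic T)‖ ^ 2) := by
    rw [← sum_periodBox_blocks M N hM, Finset.mul_sum]
    refine Finset.sum_congr rfl fun z _ => ?_
    rw [Finset.sum_congr rfl fun v hv => by rw [blk_block hM z hv], Finset.sum_const, card_periodBox, nsmul_eq_mul,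
      Nat.cast_pow]
  -- shift invariance of the periodic coarse sums
  have hperD : ∀ (α : Fin d) (x : Site d) (κ : Fin d), ‖gaugeDir U m (x + (N : ℤ) • e κ) α‖ ^ 2 = ‖gaugeDir U m x α‖ ^ 2 := by
    intro α x κ
    simp only [gaugeDir]
    rw [hUP x κ α, add_right_comm, hm, hm]
  have hshiftD : ∀ (α : Fin d) (T : Finset (Fin d)),
      ∑ z ∈ periodBox (d := d) N, ‖gaugeDir U m (z + indic T) α‖ ^ 2 = ∑ z ∈ periodBox (d := d) N, ‖gaugeDir U m z α‖ ^ 2 :=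
    fun α T => sum_periodBox_shift N hN (g := fun z => ‖gaugeDir U m z α‖ ^ 2) (hperD α) (indic T)
  have hshiftM : ∀ T : Finset (Fin d), ∑ z ∈ periodBox (d := d) N, ‖m (z + indic T)‖ ^ 2 = Dm :=
    fun T => sum_periodBox_shift N hN (g := fun z => ‖m z‖ ^ 2) (fun x κ => by simp only [hm]) (indic T)
  have hcardE : ∀ α : Fin d, (((Finset.univ : Finset (Fin d)).erase α).powerset.card : ℝ) = (2 : ℝ) ^ (d - 1) := by
    intro α
    rw [Finset.card_powerset, Finset.card_erase_of_mem (Finset.mem_univ α), Finset.card_univ, Fintype.card_fin]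
    push_cast; ring
  have hcardU : (((Finset.univ : Finset (Fin d)).powerset.card : ℝ)) = (2 : ℝ) ^ d := by
    rw [Finset.card_powerset, Finset.card_univ, Fintype.card_fin]; push_cast; ring
  -- the inner `z`-sums, per direction `α`
  have hinner : ∀ α : Fin d, ∑ z ∈ periodBox (d := d) N,
      ((4 / (M : ℝ) ^ 2) * ∑ T ∈ (Finset.univ.erase α).powerset, ‖gaugeDir U m (z + indic T) α‖ ^ 2
        + K * ∑ T ∈ (Finset.univ : Finset (Fin d)).powerset, ‖m (z + indic T)‖ ^ 2)
      = (2 : ℝ) ^ (d + 1) / (M : ℝ) ^ 2 * ∑ z ∈ periodBox (d := d) N, ‖gaugeDir U m z α‖ ^ 2 + K * ((2 : ℝ) ^ d * Dm) := by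
    intro α
    have hd1 : 1 ≤ d := Fin.pos α
    rw [Finset.sum_add_distrib, ← Finset.mul_sum, ← Finset.mul_sum, Finset.sum_comm,
      Finset.sum_congr rfl fun T _ => hshiftD α T, Finset.sum_const, nsmul_eq_mul, hcardE,
      Finset.sum_comm, Finset.sum_congr rfl fun T _ => hshiftM T, Finset.sum_const, nsmul_eq_mul, hcardU]
    have h2 : (4 : ℝ) * (2 : ℝ) ^ (d - 1) = (2 : ℝ) ^ (d + 1) := by
      obtain ⟨d', rfl⟩ := Nat.exists_eq_add_of_le hd1
      rw [show 1 + d' - 1 = d' by omega, show 1 + d' + 1 = d' + 2 by omega, pow_add]; ring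
    rw [← h2]
    ring
  calc ∑ y ∈ periodBox (d := d) (M * N), ∑ α : Fin d, ‖gaugeDir W (tinterpW M W m) y α‖ ^ 2
      ≤ ∑ y ∈ periodBox (d := d) (M * N), ∑ α : Fin d,
          ((4 / (M : ℝ) ^ 2) * ∑ T ∈ (Finset.univ.erase α).powerset, ‖gaugeDir U m (blk M y + indic T) α‖ ^ 2
            + K * ∑ T ∈ (Finset.univ : Finset (Fin d)).powerset, ‖m (blk M y + indic T)‖ ^ 2) :=
        Finset.sum_le_sum fun y _ => Finset.sum_le_sum fun α _ => hpt y α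
    _ = (M : ℝ) ^ d * ∑ z ∈ periodBox (d := d) N, ∑ α : Fin d,
          ((4 / (M : ℝ) ^ 2) * ∑ T ∈ (Finset.univ.erase α).powerset, ‖gaugeDir U m (z + indic T) α‖ ^ 2
            + K * ∑ T ∈ (Finset.univ : Finset (Fin d)).powerset, ‖m (z + indic T)‖ ^ 2) := hblocks
    _ = (M : ℝ) ^ d * ∑ α : Fin d,
          ((2 : ℝ) ^ (d + 1) / (M : ℝ) ^ 2 * ∑ z ∈ periodBox (d := d) N, ‖gaugeDir U m z α‖ ^ 2 + K * ((2 : ℝ) ^ d * Dm)) := by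
        rw [Finset.sum_comm, Finset.sum_congr rfl fun α _ => hinner α]
    _ = (2 : ℝ) ^ (d + 1) * ((M : ℝ) ^ d / (M : ℝ) ^ 2) * ∑ z ∈ periodBox (d := d) N, ∑ α : Fin d, ‖gaugeDir U m z α‖ ^ 2
          + (d : ℝ) * (2 : ℝ) ^ d * (M : ℝ) ^ d * K * Dm := by
        rw [Finset.sum_add_distrib, ← Finset.mul_sum, Finset.sum_const, Finset.card_univ, Fintype.card_fin, nsmul_eq_mul,
          Finset.sum_comm]
        ring

end End

end

end Summit.QuantumFields.BalabanUV.T4Continuum.NE3CovariantTentInterpolantEnergy
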